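import Summits.KontsevichZagierPeriods.KontsevichZagierPeriods.Theorems.SymplecticScissorsVolumeFormOffPlaneUnionSplit
import Literature.NumberTheory.Transcendental.KZLogCalculusProofs

/-!
# `VolumeFormOffPlane` (stmt-KontsevichZagierPeriods-14935) — line `Sketch`,
stub `stub_cornerCertificate` (corner cells are certified)

A *corner cell* of the cut-box decomposition (`stub_cornerCut`) is the set
`{p | (∀ ι, e ι < x ι) ∧ ∏ ι, x ι ^ m ι < c ∧ 0 < z ∧ z · ∏ ι, x ι < 1}` in torus coordinates
`x ι = p (Fin.castSucc ι)`, slack `z = p (Fin.last (n + 1))`, with `e ι > 0` real algebraic,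
`m ι > 0` and `c = (∏ ι, e ι ^ m ι) · α ^ su · β ^ sv`.  Given the binomial-cell certificate
(the statement of `stub_binomialCertificate`, taken here as a hypothesis), every integrand-`1`
representation on a corner cell has a torsion certificate by integrand-`1` representations on
log-boxes.

Proof, by cases on the ratio `α ^ su · β ^ sv`:

* ratio `> 1`: the corner cell *is* the binomial cell of the diagonal exponent matrix
  `M = diagonal m` with `sa ι = e ι ^ m ι`, `sc = c`: for the diagonal matrix
  `∏ j, x j ^ M k j = x k ^ m k` (`Finset.prod_eq_single`), and for positive reals and `m k ≠ 0`
  one has `e k ^ m k < x k ^ m k ↔ e k < x k`; `det M = ∏ (m ι : ℤ) ≠ 0`.  The binomial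
  certificate applies verbatim.
* ratio `≤ 1`: then `c ≤ ∏ ι, e ι ^ m ι ≤ ∏ ι, x ι ^ m ι` on the cell, contradicting
  `∏ ι, x ι ^ m ι < c`; the cell is empty, `[ρ]` is itself a relation
  (`KZ.of_mem_relations_of_volume_eq_zero`) and the empty certificate `d = 1`, `l = 0` works.

Sources: folklore (bookkeeping over the KZ calculus, Kontsevich–Zagier 2001, §1.2).
-/

noncomputable section

open MeasureTheory Set
open Literature.NumberTheory.Transcendental

namespace Summit.KontsevichZagierPeriods.SymplecticScissors.LogPolytope

/-- For the diagonal integer matrix with natural diagonal `m`, the binomial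
`∏ j, x j ^ (diagonal m) k j` is the monomial `x k ^ m k`. [folklore] -/
theorem ccert_prod_zpow_diagonal {ι : Type*} [Fintype ι] [DecidableEq ι] (m : ι → ℕ)
    (x : ι → ℝ) (k : ι) :
    ∏ j, x j ^ (Matrix.diagonal (fun i => (m i : ℤ)) k j) = x k ^ (m k) := by
  rw [Finset.prod_eq_single k]
  · rw [Matrix.diagonal_apply_eq, zpow_natCast]
  · intro j _ hjk
    rw [Matrix.diagonal_apply_ne _ (Ne.symm hjk), zpow_zero]
  · intro h
    exact absurd (Finset.mem_univ k) h

/-- The diagonal integer matrix with positive natural diagonal has non-zero determinant.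
[folklore] -/
theorem ccert_det_diagonal_ne_zero {ι : Type*} [Fintype ι] [DecidableEq ι] (m : ι → ℕ)
    (hm : ∀ i, 0 < m i) : (Matrix.diagonal (fun i => (m i : ℤ))).det ≠ 0 := by
  rw [Matrix.det_diagonal]
  exact Finset.prod_ne_zero_iff.mpr fun i _ => by exact_mod_cast (hm i).ne'

/-- A corner cell `{e < x, ∏ x ^ m < c, slack}` (`e > 0`, `m > 0`) is the binomial cell of the
diagonal exponent matrix `diagonal m` with lower bounds `e ι ^ m ι` and the same cut `c`.
[folklore] -/
theorem ccert_corner_eq_binomial (n : ℕ) (e : Fin (n + 1) → ℝ) (m : Fin (n + 1) → ℕ) (c : ℝ)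
    (he : ∀ ι, 0 < e ι) (hm : ∀ ι, 0 < m ι) :
    {p : Fin (n + 1 + 1) → ℝ | (∀ ι : Fin (n + 1), e ι < p (Fin.castSucc ι)) ∧
        ∏ ι : Fin (n + 1), p (Fin.castSucc ι) ^ (m ι) < c ∧ 0 < p (Fin.last (n + 1)) ∧
        p (Fin.last (n + 1)) * ∏ ι : Fin (n + 1), p (Fin.castSucc ι) < 1} =
    {p : Fin (n + 1 + 1) → ℝ | (∀ ι : Fin (n + 1), 0 < p (Fin.castSucc ι)) ∧
      (∀ k : Fin (n + 1), (fun ι => e ι ^ (m ι)) k <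
        ∏ j : Fin (n + 1), p (Fin.castSucc j) ^ (Matrix.diagonal (fun ι => (m ι : ℤ)) k j)) ∧
      ∏ k : Fin (n + 1), ∏ j : Fin (n + 1),
        p (Fin.castSucc j) ^ (Matrix.diagonal (fun ι => (m ι : ℤ)) k j) < c ∧
      0 < p (Fin.last (n + 1)) ∧
      p (Fin.last (n + 1)) * ∏ ι : Fin (n + 1), p (Fin.castSucc ι) < 1} := by
  ext p
  simp only [Set.mem_setOf_eq, ccert_prod_zpow_diagonal]
  constructor
  · rintro ⟨h1, h2, h3, h4⟩
    refine ⟨fun ι => (he ι).trans (h1 ι), fun k => ?_, h2, h3, h4⟩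
    exact pow_lt_pow_left₀ (h1 k) (he k).le (hm k).ne'
  · rintro ⟨h0, h1, h2, h3, h4⟩
    refine ⟨fun ι => ?_, h2, h3, h4⟩
    exact lt_of_pow_lt_pow_left₀ (m ι) (h0 ι).le (h1 ι)

/-- **Corner cells are certified.** Given the binomial-cell certificate (hypothesis), every
integrand-`1` representation on a corner cell `{e < x, ∏ x ^ m < c, slack}` with `e > 0` real
algebraic, `m > 0`, `c = (∏ e ^ m) · α ^ su · β ^ sv` has a torsion certificate by integrand-`1`
representations on log-boxes: if the ratio `α ^ su · β ^ sv` exceeds `1` the corner cell is the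
binomial cell of the diagonal matrix `diagonal m`; otherwise the cell is empty and the empty
certificate works. [folklore] -/
theorem stub_cornerCertificate : ∀ (n : ℕ) (α β : ℝ), 0 < α → 0 < β → IsAlgebraic ℚ α → IsAlgebraic ℚ β →
    (∀ (n : ℕ) (α β : ℝ), 0 < α → 0 < β → IsAlgebraic ℚ α → IsAlgebraic ℚ β →
      ∀ (M : Matrix (Fin (n + 1)) (Fin (n + 1)) ℤ) (sa : Fin (n + 1) → ℝ) (sc : ℝ) (su sv : ℚ)
      (ρ : KZ.IntegralRep (n + 1 + 1)),
      M.det ≠ 0 → (∀ ι, 0 < sa ι) → (∀ ι, IsAlgebraic ℚ (sa ι)) → IsAlgebraic ℚ sc →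
      sc = (∏ ι, sa ι) * (α ^ ((su : ℚ) : ℝ) * β ^ ((sv : ℚ) : ℝ)) →
      1 < α ^ ((su : ℚ) : ℝ) * β ^ ((sv : ℚ) : ℝ) →
      ρ.domain = {p : Fin (n + 1 + 1) → ℝ | (∀ ι : Fin (n + 1), 0 < p (Fin.castSucc ι)) ∧
      (∀ k : Fin (n + 1), sa k < ∏ j : Fin (n + 1), p (Fin.castSucc j) ^ (M k j)) ∧
      ∏ k : Fin (n + 1), ∏ j : Fin (n + 1), p (Fin.castSucc j) ^ (M k j) < sc ∧
      0 < p (Fin.last (n + 1)) ∧ p (Fin.last (n + 1)) * ∏ ι : Fin (n + 1), p (Fin.castSucc ι) < 1} →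
      (∀ p ∈ ρ.domain, ρ.integrand p = 1) →
      ∃ (d l : ℕ) (σ : Fin l → KZ.IntegralRep (n + 1 + 1)) (w : Fin l → ℤ), d ≠ 0 ∧
      (∀ j, w j ≠ 0 → ∃ (a : Fin (n + 1) → ℝ) (u v : Fin (n + 1) → ℚ),
      (∀ ξ ∈ (σ j).domain, (σ j).integrand ξ = 1) ∧ (∀ ι, 0 < a ι) ∧
      (∀ ι, IsAlgebraic ℚ (a ι)) ∧ (∀ ι, 1 < α ^ ((u ι : ℚ) : ℝ) * β ^ ((v ι : ℚ) : ℝ)) ∧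
      (σ j).domain = {ξ : Fin (n + 1 + 1) → ℝ | (∀ ι : Fin (n + 1), a ι < ξ (Fin.castSucc ι) ∧
      ξ (Fin.castSucc ι) < a ι * (α ^ ((u ι : ℚ) : ℝ) * β ^ ((v ι : ℚ) : ℝ))) ∧
      0 < ξ (Fin.last (n + 1)) ∧ ξ (Fin.last (n + 1)) * ∏ ι : Fin (n + 1), ξ (Fin.castSucc ι) < 1}) ∧
      d • KZ.of ρ - ∑ j, w j • KZ.of (σ j) ∈ KZ.relations) →
    ∀ (e : Fin (n + 1) → ℝ) (m : Fin (n + 1) → ℕ) (c : ℝ) (su sv : ℚ) (ρ : KZ.IntegralRep (n + 1 + 1)),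
    (∀ ι, 0 < e ι) → (∀ ι, IsAlgebraic ℚ (e ι)) → (∀ ι, 0 < m ι) → IsAlgebraic ℚ c →
    c = (∏ ι, e ι ^ (m ι)) * (α ^ ((su : ℚ) : ℝ) * β ^ ((sv : ℚ) : ℝ)) →
    ρ.domain = {p : Fin (n + 1 + 1) → ℝ | (∀ ι : Fin (n + 1), e ι < p (Fin.castSucc ι)) ∧
        ∏ ι : Fin (n + 1), p (Fin.castSucc ι) ^ (m ι) < c ∧ 0 < p (Fin.last (n + 1)) ∧
        p (Fin.last (n + 1)) * ∏ ι : Fin (n + 1), p (Fin.castSucc ι) < 1} →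
    (∀ p ∈ ρ.domain, ρ.integrand p = 1) →
    ∃ (d l : ℕ) (σ : Fin l → KZ.IntegralRep (n + 1 + 1)) (w : Fin l → ℤ), d ≠ 0 ∧
        (∀ j, w j ≠ 0 → ∃ (a : Fin (n + 1) → ℝ) (u v : Fin (n + 1) → ℚ),
          (∀ ξ ∈ (σ j).domain, (σ j).integrand ξ = 1) ∧ (∀ ι, 0 < a ι) ∧
          (∀ ι, IsAlgebraic ℚ (a ι)) ∧ (∀ ι, 1 < α ^ ((u ι : ℚ) : ℝ) * β ^ ((v ι : ℚ) : ℝ)) ∧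
          (σ j).domain = {ξ : Fin (n + 1 + 1) → ℝ | (∀ ι : Fin (n + 1), a ι < ξ (Fin.castSucc ι) ∧
            ξ (Fin.castSucc ι) < a ι * (α ^ ((u ι : ℚ) : ℝ) * β ^ ((v ι : ℚ) : ℝ))) ∧
            0 < ξ (Fin.last (n + 1)) ∧ ξ (Fin.last (n + 1)) * ∏ ι : Fin (n + 1), ξ (Fin.castSucc ι) < 1}) ∧
        d • KZ.of ρ - ∑ j, w j • KZ.of (σ j) ∈ KZ.relations := by
  intro n α β hα hβ hαa hβa HBIN e m c su sv ρ he hea hm hca hc hdom hint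
  by_cases hr : 1 < α ^ ((su : ℚ) : ℝ) * β ^ ((sv : ℚ) : ℝ)
  · -- the corner cell is the binomial cell of the diagonal exponent matrix
    exact HBIN n α β hα hβ hαa hβa (Matrix.diagonal (fun ι => (m ι : ℤ))) (fun ι => e ι ^ (m ι))
      c su sv ρ (ccert_det_diagonal_ne_zero m hm) (fun ι => pow_pos (he ι) _)
      (fun ι => (hea ι).pow _) hca hc hr
      (hdom.trans (ccert_corner_eq_binomial n e m c he hm)) hint
  · -- the corner cell is empty
    have hle : c ≤ ∏ ι, e ι ^ (m ι) := by
      rw [hc]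
      exact mul_le_of_le_one_right (Finset.prod_nonneg fun ι _ => (pow_pos (he ι) _).le)
        (not_lt.mp hr)
    have hempty : ρ.domain = ∅ := by
      rw [hdom, Set.eq_empty_iff_forall_notMem]
      rintro p ⟨h1, h2, -, -⟩
      have hprod : ∏ ι, e ι ^ (m ι) ≤ ∏ ι, p (Fin.castSucc ι) ^ (m ι) :=
        Finset.prod_le_prod (fun ι _ => (pow_pos (he ι) _).le)
          fun ι _ => pow_le_pow_left₀ (he ι).le (h1 ι).le _
      exact lt_irrefl _ ((h2.trans_le hle).trans_le hprod)
    have h : KZ.of ρ ∈ KZ.relations :=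
      KZ.of_mem_relations_of_volume_eq_zero ρ (by rw [hempty]; exact measure_empty)
    refine ⟨1, 0, Fin.elim0, Fin.elim0, one_ne_zero, fun j => j.elim0, ?_⟩
    simpa using h

end Summit.KontsevichZagierPeriods.SymplecticScissors.LogPolytope

end
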